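import Literature.Geometry.Kaehler.ManifoldFormsPullback
import Literature.Geometry.Symplectic.SteinBoundaryContactCondition
import Literature.Topology.FourManifolds.Cobordism
import HarnessLib

/-!
# Conformally related `1`-forms, and the seam of a Stein bisection read on the boundary manifold

Topic `Literature/Geometry/Symplectic`; the differential-geometric half of the seam-transport
invariance of the twisting number (`SteinSeamConformal.lean`: the winding-number half;
`SteinSeamTwisting.lean`: the assembly).  A contactomorphism `ψ : (M₁, ξ₁) → (M₂, ξ₂)` of
co-oriented contact manifolds, `ξᵢ = ker αᵢ`, satisfies `ψ^*α₂ = f α₁` for a nowhere-zero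
function `f` (Geiges, *An Introduction to Contact Topology* (2008), Def. 2.1.5 and the remark
following it), and then `ψ^*(dα₂)|_{ξ₁} = f · dα₁|_{ξ₁}` (the term `df ∧ α₁` dies on `ker α₁`).
For the seam of a Stein bisection `X = e₁(W₁) ∪ e₂(W₂)` the tree has neither `∂Wᵢ` as contact
manifolds nor `ψ`; this file provides exactly the pieces needed to run the argument on an
abstract boundary datum `b₁ : BoundaryData (𝓡∂ 4) W₁ (𝓡 3)` (`Cobordism.lean`) with the forms of
`ManifoldForms.lean` (`MForm`, `mextDeriv`, pull-back and naturality of `d`,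
`ManifoldFormsPullback.lean`):

* `extDeriv_apply_eq_mul_of_eventuallyEq_smul` — on a normed space: if `A' = g • A` near `y₀`
  for `1`-form fields differentiable at `y₀` with `A(y₀) ≠ 0`, then
  `dA'(y₀)(u, v) = g(y₀) dA(y₀)(u, v)` for `u, v ∈ ker A(y₀)` (`g` is differentiable at `y₀` as
  the quotient `A'(R)/A(R)`; Leibniz `fderiv_fun_smul`; Mathlib's `extDeriv`);
* `exists_conformalFactor_of_ker_eq` — **two smooth `1`-forms `a`, `a'` on a boundaryless
  manifold with the same kernel, `a` nowhere zero, are related by a continuous nowhere-zero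
  conformal factor `F`, `a' = F a`, and `da' = F da` on pairs of kernel vectors** (read in the
  chart at the point, `mextDeriv_eq_extDerivWithin`);
* `mfderiv_apply_mem_boundaryTangentSpace`, `exists_mfderiv_incl_eq` — a map of a `3`-manifold
  into `W` taking a point to `∂W` has differential valued in the boundary hyperplane
  `T∂W = {v | v 0 = 0}` there (Fermat on the normal coordinate), and the differential of a
  boundary inclusion maps ONTO `T∂W` (injective, `dim T∂W = 3`);
* `liouvilleForm_pullback` — the pull-back `g^*(-d^ℂφ)` of the Liouville form of a Stein
  structure along a smooth map `g` of a `3`-manifold is smooth, evaluates to `α(dg u)`, and has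
  `d(g^*(-d^ℂφ))(u, v) = ω(dg u, dg v)` (naturality of `d`, `dα = ω`);

The first two items are general (any real normed space / any manifold modelled on `𝓘(ℝ, E)`);
the boundary items are adapted from the support file `Negative/DoubleBisection.lean` of crux
stmt-SmoothPoincare4-3546, which lives under `Summits/` and is not importable here.  The seam
partner map and the assembly are in `SteinSeamTwisting.lean`.

## References

* H. Geiges, *An Introduction to Contact Topology*, CUP (2008), Def. 2.1.5. [Geiges2008]
* F. W. Warner, *Foundations of Differentiable Manifolds and Lie Groups*, GTM 94 (1983),
  Prop. 2.23 (naturality of `d`). [WarnerGTM94]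
-/

noncomputable section

open scoped Manifold ContDiff Topology
open Set Function Filter

namespace Literature.Geometry.Symplectic

open Literature.Geometry.Kaehler

/-! ### `d` of proportional `1`-forms on a normed space -/

section Chart

variable {E : Type*} [NormedAddCommGroup E] [NormedSpace ℝ E]

/-- A `1`-form only sees the single entry of its argument. [folklore] -/
theorem form_one_apply_eq (φ : E [⋀^Fin 1]→L[ℝ] ℝ) (w : Fin 1 → E) : φ w = φ ![w 0] := by
  congr 1
  funext i
  fin_cases i
  rfl

/-- Linearity of a `1`-form in its single slot: `φ(x + c r) = φ(x) + c φ(r)`. [folklore] -/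
theorem form_one_apply_add_smul (φ : E [⋀^Fin 1]→L[ℝ] ℝ) (x r : E) (c : ℝ) :
    φ ![x + c • r] = φ ![x] + c * φ ![r] := by
  rw [φ.vecCons_add ![] x (c • r), φ.vecCons_smul ![] c r, smul_eq_mul]

/-- **`d` of a `1`-form on two vectors** (Mathlib's normalisation of `extDeriv`):
`alternatizeUncurryFin L (u, v) = L u (v) - L v (u)`. [folklore] -/
theorem alternatizeUncurryFin_apply_two (L : E →L[ℝ] (E [⋀^Fin 1]→L[ℝ] ℝ)) (u v : E) :
    ContinuousAlternatingMap.alternatizeUncurryFin L ![u, v] = L u ![v] - L v ![u] := by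
  rw [ContinuousAlternatingMap.alternatizeUncurryFin_apply, Fin.sum_univ_two]
  have h0 : Fin.removeNth 0 ![u, v] = ![v] := by
    funext i
    fin_cases i
    rfl
  have h1 : Fin.removeNth 1 ![u, v] = ![u] := by
    funext i
    fin_cases i
    rfl
  rw [h0, h1]
  simp only [Fin.val_zero, pow_zero, one_smul, Fin.val_one, pow_one, neg_smul, one_smul,
    Matrix.cons_val_zero, Matrix.cons_val_one]
  rw [sub_eq_add_neg]

/-- **`d` of proportional `1`-forms agree up to the factor on the common kernel** (normed-space
form).  If `A' = g • A` near `y₀` for `1`-form fields `A`, `A'` differentiable at `y₀` with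
`A(y₀) ≠ 0`, then `g` is differentiable at `y₀` (it is the quotient `A'(R)/A(R)` near `y₀` for a
vector `R` with `A(y₀)(R) ≠ 0`), `dA'(y₀) = g(y₀) dA(y₀) + dg ∧ A(y₀)` (Leibniz), and the last
term vanishes on pairs of vectors of `ker A(y₀)`:
`dA'(y₀)(u, v) = g(y₀) · dA(y₀)(u, v)` for `u, v ∈ ker A(y₀)`.  This is the computation behind
"`α' = g α ⟹ dα'|_{ker α} = g dα|_{ker α}`" for contact forms (Geiges 2008, §1.1 / Lemma 1.1.6
neighbourhood). [folklore] -/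
theorem extDeriv_apply_eq_mul_of_eventuallyEq_smul {A A' : E → E [⋀^Fin 1]→L[ℝ] ℝ} {y₀ : E}
    (hA : DifferentiableAt ℝ A y₀) (hA' : DifferentiableAt ℝ A' y₀) {g : E → ℝ}
    (hg : A' =ᶠ[𝓝 y₀] fun y => g y • A y) {R : E} (hR : A y₀ ![R] ≠ 0) {u v : E}
    (hu : A y₀ ![u] = 0) (hv : A y₀ ![v] = 0) :
    extDeriv A' y₀ ![u, v] = g y₀ * extDeriv A y₀ ![u, v] := by
  -- `g` is the quotient `A'(R)/A(R)` near `y₀`, hence differentiable at `y₀`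
  have hAR : DifferentiableAt ℝ (fun y => A y ![R]) y₀ :=
    hA.continuousAlternatingMap_apply (g := fun (i : Fin 1) (_ : E) => (![R] : Fin 1 → E) i)
      fun _ => differentiableAt_const _
  have hA'R : DifferentiableAt ℝ (fun y => A' y ![R]) y₀ :=
    hA'.continuousAlternatingMap_apply (g := fun (i : Fin 1) (_ : E) => (![R] : Fin 1 → E) i)
      fun _ => differentiableAt_const _
  have hne : ∀ᶠ y in 𝓝 y₀, A y ![R] ≠ 0 := hAR.continuousAt.eventually_ne hR
  have hgq : g =ᶠ[𝓝 y₀] fun y => A' y ![R] * (A y ![R])⁻¹ := by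
    filter_upwards [hg, hne] with y hy hy0
    rw [hy, ContinuousAlternatingMap.smul_apply, smul_eq_mul, mul_inv_cancel_right₀ hy0]
  have hgd : DifferentiableAt ℝ g y₀ :=
    (hA'R.fun_mul (hAR.fun_inv hR)).congr_of_eventuallyEq hgq
  -- Leibniz
  have hfd : fderiv ℝ A' y₀ = g y₀ • fderiv ℝ A y₀ + (fderiv ℝ g y₀).smulRight (A y₀) := by
    rw [hg.fderiv_eq]
    exact fderiv_fun_smul hgd hA
  show ContinuousAlternatingMap.alternatizeUncurryFin (fderiv ℝ A' y₀) ![u, v] =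
    g y₀ * ContinuousAlternatingMap.alternatizeUncurryFin (fderiv ℝ A y₀) ![u, v]
  rw [alternatizeUncurryFin_apply_two, alternatizeUncurryFin_apply_two, hfd]
  simp only [_root_.add_apply, _root_.smul_apply,
    ContinuousLinearMap.smulRight_apply, ContinuousAlternatingMap.add_apply,
    ContinuousAlternatingMap.smul_apply, hu, hv, smul_eq_mul, mul_zero, add_zero]
  ring

end Chart

/-! ### Conformally related smooth `1`-forms on a manifold -/

section ManifoldForms

variable {E : Type*} [NormedAddCommGroup E] [NormedSpace ℝ E] {M : Type*} [TopologicalSpace M]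
  [ChartedSpace E M] [IsManifold 𝓘(ℝ, E) ∞ M]

/-- **The conformal factor of two smooth `1`-forms with the same kernel.**  Let `a`, `a'` be
smooth `1`-forms on a boundaryless manifold `M` with `ker a_z = ker a'_z` and `a_z ≠ 0` at every
point.  Then there is a continuous nowhere-vanishing function `F : M → ℝ` with `a' = F a`, and
on pairs of vectors of the common kernel the exterior derivatives are related by the same
factor: `da'_z(u, v) = F(z) · da_z(u, v)` for `u, v ∈ ker a_z` (in the chart at `z`,
`extDeriv_apply_eq_mul_of_eventuallyEq_smul`).  For contact forms this is the statement that a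
contactomorphism rescales `α` and `dα|_ξ` by one and the same conformal factor
(Geiges 2008, Def. 2.1.5 and §1.1). [cite: Geiges2008, Def. 2.1.5] -/
theorem exists_conformalFactor_of_ker_eq {a a' : MForm 𝓘(ℝ, E) M ℝ 1} (ha : IsSmoothForm a)
    (ha' : IsSmoothForm a') (hker : ∀ (z : M) (u : E), a z ![u] = 0 ↔ a' z ![u] = 0)
    (hne : ∀ z : M, ∃ u : E, a z ![u] ≠ 0) :
    ∃ F : M → ℝ, Continuous F ∧ (∀ z, F z ≠ 0) ∧ (∀ (z : M) (w : Fin 1 → E), a' z w = F z * a z w) ∧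
      ∀ (z : M) (u v : E), a z ![u] = 0 → a z ![v] = 0 →
        mextDeriv a' z ![u, v] = F z * mextDeriv a z ![u, v] := by
  -- read the forms as non-dependent functions into `E [⋀^Fin 1]→L[ℝ] ℝ` (`TangentSpace = E`)
  set α : M → E [⋀^Fin 1]→L[ℝ] ℝ := fun z => a z with hα
  set α' : M → E [⋀^Fin 1]→L[ℝ] ℝ := fun z => a' z with hα'
  have hker' : ∀ (z : M) (u : E), α z ![u] = 0 ↔ α' z ![u] = 0 := hker
  have hne' : ∀ z : M, ∃ u : E, α z ![u] ≠ 0 := hne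
  choose R hR using hne'
  set F : M → ℝ := fun z => α' z ![R z] / α z ![R z] with hF
  -- pointwise proportionality
  have hprop : ∀ (z : M) (w : Fin 1 → E), α' z w = F z * α z w := by
    intro z w
    rw [form_one_apply_eq (α' z) w, form_one_apply_eq (α z) w]
    set x : E := w 0
    set c : ℝ := α z ![x] / α z ![R z] with hc
    have h1 : α z ![x + (-c) • R z] = 0 := by
      rw [form_one_apply_add_smul, hc, neg_mul, div_mul_cancel₀ _ (hR z), add_neg_cancel]
    have h2 : α' z ![x + (-c) • R z] = 0 := (hker' z _).1 h1
    rw [form_one_apply_add_smul] at h2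
    have h3 : α' z ![x] = c * α' z ![R z] := by linarith
    rw [h3, hc, hF]
    simp only
    rw [div_mul_eq_mul_div, div_mul_eq_mul_div, mul_comm]
  have hF0 : ∀ z, F z ≠ 0 := fun z =>
    div_ne_zero (fun h => hR z ((hker' z _).2 h)) (hR z)
  -- chart data at a point
  have hrange : range (𝓘(ℝ, E) : ModelWithCorners ℝ E E) = univ := ModelWithCorners.range_eq_univ _
  have hchart : ∀ z₀ : M,
      (∀ y, a'.inChart z₀ y = F ((extChartAt 𝓘(ℝ, E) z₀).symm y) • a.inChart z₀ y) ∧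
      ContDiffAt ℝ ∞ (a.inChart z₀) (extChartAt 𝓘(ℝ, E) z₀ z₀) ∧
      ContDiffAt ℝ ∞ (a'.inChart z₀) (extChartAt 𝓘(ℝ, E) z₀ z₀) ∧
      a.inChart z₀ (extChartAt 𝓘(ℝ, E) z₀ z₀) ![R z₀] ≠ 0 := by
    intro z₀
    refine ⟨fun y => ?_, ?_, ?_, ?_⟩
    · ext w
      change a'.inChart z₀ y w = F ((extChartAt 𝓘(ℝ, E) z₀).symm y) * a.inChart z₀ y w
      rw [MForm.inChart_apply, MForm.inChart_apply]
      exact hprop _ _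
    · have h : ContDiffWithinAt ℝ ∞ (a.inChart z₀) (range 𝓘(ℝ, E)) (extChartAt 𝓘(ℝ, E) z₀ z₀) :=
        ha z₀
      rwa [hrange, contDiffWithinAt_univ] at h
    · have h : ContDiffWithinAt ℝ ∞ (a'.inChart z₀) (range 𝓘(ℝ, E)) (extChartAt 𝓘(ℝ, E) z₀ z₀) :=
        ha' z₀
      rwa [hrange, contDiffWithinAt_univ] at h
    · rw [MForm.inChart_apply_self]
      exact hR z₀
  -- continuity of `F`
  have hcont : Continuous F := by
    rw [continuous_iff_continuousAt]
    intro z₀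
    obtain ⟨hAA', hAc, hA'c, hR₀⟩ := hchart z₀
    set φ := extChartAt 𝓘(ℝ, E) z₀ with hφ
    set A := a.inChart z₀ with hA
    set A' := a'.inChart z₀ with hA'
    -- the quotient `A'(R₀)/A(R₀)` is continuous at `φ z₀` and agrees with `F ∘ φ.symm` nearby
    have hq : ContinuousAt (fun y => A' y ![R z₀] / A y ![R z₀]) (φ z₀) :=
      (hA'c.continuousAt.eval_const _).div (hAc.continuousAt.eval_const _) hR₀
    have hne : ∀ᶠ y in 𝓝 (φ z₀), A y ![R z₀] ≠ 0 := (hAc.continuousAt.eval_const _).eventually_ne hR₀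
    have hG : ContinuousAt (F ∘ φ.symm) (φ z₀) := by
      refine hq.congr ?_
      filter_upwards [hne] with y hy
      have h := congrArg (fun ψ : E [⋀^Fin 1]→L[ℝ] ℝ => ψ ![R z₀]) (hAA' y)
      simp only [ContinuousAlternatingMap.smul_apply, smul_eq_mul] at h
      show A' y ![R z₀] / A y ![R z₀] = F (φ.symm y)
      rw [h, mul_div_cancel_right₀ _ hy]
    have hcomp : ContinuousAt ((F ∘ φ.symm) ∘ φ) z₀ := hG.comp (continuousAt_extChartAt z₀)
    refine hcomp.congr ?_
    filter_upwards [extChartAt_source_mem_nhds (I := 𝓘(ℝ, E)) z₀] with z hz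
    show F (φ.symm (φ z)) = F z
    rw [φ.left_inv hz]
  refine ⟨F, hcont, hF0, hprop, fun z₀ u v hu hv => ?_⟩
  -- the `d`-relation, in the chart at `z₀`
  obtain ⟨hAA', hAc, hA'c, hR₀⟩ := hchart z₀
  have hu' : a.inChart z₀ (extChartAt 𝓘(ℝ, E) z₀ z₀) ![u] = 0 := by
    rw [MForm.inChart_apply_self]; exact hu
  have hv' : a.inChart z₀ (extChartAt 𝓘(ℝ, E) z₀ z₀) ![v] = 0 := by
    rw [MForm.inChart_apply_self]; exact hv
  have key := extDeriv_apply_eq_mul_of_eventuallyEq_smul (hAc.differentiableAt (by simp))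
    (hA'c.differentiableAt (by simp)) (g := fun y => F ((extChartAt 𝓘(ℝ, E) z₀).symm y))
    (Eventually.of_forall hAA') hR₀ hu' hv'
  rw [extChartAt_to_inv] at key
  rw [mextDeriv_eq_extDerivWithin, mextDeriv_eq_extDerivWithin, hrange, extDerivWithin_univ,
    extDerivWithin_univ]
  exact key

end ManifoldForms

/-! ### Maps of `3`-manifolds into the boundary of a `4`-manifold -/

section BoundaryMaps

open Literature.Topology.FourManifolds Module

variable {W : Type*} [TopologicalSpace W] [ChartedSpace (EuclideanHalfSpace 4) W]

/-- The model vector space `ℝ³` of the boundary `3`-manifolds. [folklore] -/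
local notation "E3" => EuclideanSpace ℝ (Fin 3)

/-- The model vector space `ℝ⁴` of the tangent spaces. [folklore] -/
local notation "E4" => EuclideanSpace ℝ (Fin 4)

/-- **Maps into the boundary are tangent to it.**  For a map `f` from a boundaryless
`3`-manifold into `W` and a point `z` with `f z ∈ ∂W`, every value `df_z u` lies in the boundary
hyperplane `T∂W = {v | v 0 = 0}` of the preferred chart at `f z`: the normal coordinate
`y ↦ (chart (f z) (f y)) 0` is `≥ 0` everywhere and `= 0` at `z`, so Fermat's theorem kills its
derivative (and the junk value `mfderiv = 0` of a non-differentiable `f` lies in the hyperplane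
as well). [folklore] -/
theorem mfderiv_apply_mem_boundaryTangentSpace {N : Type*} [TopologicalSpace N]
    [ChartedSpace E3 N] (f : N → W) {z : N} (hz : f z ∈ (𝓡∂ 4).boundary W) (u : E3) :
    mfderiv (𝓡 3) (𝓡∂ 4) f z u ∈ boundaryTangentSpace := by
  -- adapted from the crux support file `Negative/DoubleBisection.lean` (A1)
  set D : E3 →L[ℝ] E4 := mfderiv (𝓡 3) (𝓡∂ 4) f z with hD
  show (D u) 0 = 0
  by_cases hf : MDifferentiableAt (𝓡 3) (𝓡∂ 4) f z
  swap
  · have h0 : D = 0 := mfderiv_zero_of_not_mdifferentiableAt hf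
    rw [h0]
    rfl
  set g : E3 → E4 := writtenInExtChartAt (𝓡 3) (𝓡∂ 4) z f with hg
  set y₀ : E3 := extChartAt (𝓡 3) z z with hy₀
  set L : E4 →L[ℝ] ℝ := EuclideanSpace.proj (0 : Fin 4) with hL
  have hLv : ∀ v : E4, L v = v 0 := fun v => rfl
  have hr : range (𝓡 3) = (univ : Set E3) := by simp
  have hnonneg : ∀ y, 0 ≤ g y 0 := by
    intro y
    simp only [hg, writtenInExtChartAt, Function.comp_apply, extChartAt,
      OpenPartialHomeomorph.extend_coe]
    exact (chartAt (EuclideanHalfSpace 4) (f z) _).property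
  have h0 : g y₀ 0 = 0 := by
    have hb := ModelWithCorners.isBoundaryPoint_iff.1 hz
    rw [frontier_range_modelWithCornersEuclideanHalfSpace] at hb
    have : g y₀ = extChartAt (𝓡∂ 4) (f z) (f z) := by
      simp [hg, hy₀, writtenInExtChartAt]
    rw [this]
    exact (hb : (0 : ℝ) = _).symm
  have hmin : IsLocalMin (L ∘ g) y₀ :=
    Filter.Eventually.of_forall fun y => by
      show L (g y₀) ≤ L (g y)
      rw [hLv, hLv, h0]
      exact hnonneg y
  have hd : DifferentiableAt ℝ g y₀ := by
    have := hf.differentiableWithinAt_writtenInExtChartAt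
    rwa [hr, differentiableWithinAt_univ] at this
  have hd0 : HasFDerivAt (L ∘ g) (L.comp (fderiv ℝ g y₀)) y₀ :=
    L.hasFDerivAt.comp y₀ hd.hasFDerivAt
  have hzero := hmin.hasFDerivAt_eq_zero hd0
  have key : (fderiv ℝ g y₀ u) 0 = 0 := by
    have := congrArg (fun T : E3 →L[ℝ] ℝ => T u) hzero
    simpa [hLv] using this
  have hm : D = fderiv ℝ g y₀ := by
    rw [hD, hf.mfderiv, hr, fderivWithin_univ]
  rw [hm]
  exact key

variable [IsManifold (𝓡∂ 4) ∞ W]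

/-- **The differential of the boundary inclusion maps onto the boundary hyperplane**: its range
lies in `T∂W` (`mfderiv_apply_mem_boundaryTangentSpace`), it is injective (a smooth embedding
is an immersion, `Manifold.IsImmersionAt.mfderiv_injective`), and `dim T∂W = 3`
(`finrank_boundaryTangentSpace`); stated as: every boundary tangent vector is the image of a
tangent vector of the boundary manifold. [folklore] -/
theorem exists_mfderiv_incl_eq (b : BoundaryData (𝓡∂ 4) W (𝓡 3)) (z : b.carrier) {v : E4}
    (hv : v ∈ boundaryTangentSpace) : ∃ u : E3, mfderiv (𝓡 3) (𝓡∂ 4) b.incl z u = v := by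
  -- adapted from the crux support file `Negative/DoubleBisection.lean` (A2)
  set D : E3 →L[ℝ] E4 := mfderiv (𝓡 3) (𝓡∂ 4) b.incl z with hD
  have hrange : LinearMap.range (D : E3 →ₗ[ℝ] E4) = boundaryTangentSpace := by
    refine Submodule.eq_of_le_of_finrank_eq ?_ ?_
    · rintro v ⟨u, rfl⟩
      exact mfderiv_apply_mem_boundaryTangentSpace b.incl (b.incl_mem_boundary z) u
    · have hinj : Injective D :=
        Manifold.IsImmersionAt.mfderiv_injective
          (b.isSmoothEmbedding.isImmersion.isImmersionAt z) (by simp)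
      have hinj' : Injective (D : E3 →ₗ[ℝ] E4) := hinj
      rw [LinearMap.finrank_range_of_inj hinj', finrank_euclideanSpace_fin,
        finrank_boundaryTangentSpace]
  rw [← hrange] at hv
  obtain ⟨u, rfl⟩ := hv
  exact ⟨u, rfl⟩

/-! ### The Liouville form of a Stein domain pulled back to a `3`-manifold mapped into `∂W` -/

variable [CompactSpace W] [T2Space W] {N : Type*} [TopologicalSpace N] [ChartedSpace E3 N]
  [IsManifold (𝓡 3) ∞ N]

/-- **The pulled-back contact form.**  For a smooth map `g` of a `3`-manifold into `W`, the
pull-back `g^*(-d^ℂφ)` of the Liouville form of a Stein structure is a smooth `1`-form whose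
value on `u` is `α(dg u)` and whose exterior derivative on `(u, v)` is `ω(dg u, dg v)`
(naturality of `d`, `mextDeriv_pullback`; `dα = ω`, `SteinStructure.mextDeriv_liouvilleForm_apply`).
[folklore] -/
theorem liouvilleForm_pullback (S : SteinStructure W) {g : N → W}
    (hg : ContMDiff (𝓡 3) (𝓡∂ 4) ∞ g) :
    IsSmoothForm ((-dComplex S.J S.φ).pullback (𝓡 3) g) ∧
      (∀ (z : N) (u : E3), (-dComplex S.J S.φ).pullback (𝓡 3) g z ![u] =
        S.contactForm (g z) (mfderiv (𝓡 3) (𝓡∂ 4) g z u)) ∧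
      ∀ (z : N) (u v : E3), mextDeriv ((-dComplex S.J S.φ).pullback (𝓡 3) g) z ![u, v] =
        S.kahlerForm (g z) (mfderiv (𝓡 3) (𝓡∂ 4) g z u) (mfderiv (𝓡 3) (𝓡∂ 4) g z v) := by
  have hsm := S.isSmoothForm_liouvilleForm
  refine ⟨Literature.NumberTheory.Transcendental.isSmoothForm_pullback hg hsm, fun z u => ?_,
    fun z u v => ?_⟩
  · rw [MForm.pullback_apply, ← S.liouvilleForm_apply]
    congr 1
    funext i
    fin_cases i
    rfl
  · rw [Literature.NumberTheory.Transcendental.mextDeriv_pullback hg hsm, MForm.pullback_apply,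
      ← S.mextDeriv_liouvilleForm_apply]
    congr 1
    funext i
    fin_cases i <;> rfl

end BoundaryMaps


end Literature.Geometry.Symplectic

end
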